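import Literature.Analysis.Convolution.DickmanTypeKernel
import Mathlib.MeasureTheory.Integral.DivergenceTheorem

/-!
# Route `FordMaynardNoSieveConst0164`, crux `NegWitness0164` (stmt-Parity-19102), line `birth`,
# stub `stub_tweakNeg0164`: the cardinal B-spline `B₅ = box^{⋆5}` at the five slice heights

Helper file (def-free) for the numerical target (I') of `…NegWitness0164Numerics`
(K. Ford, J. Maynard, *On the theory of prime producing sieves*, arXiv:2407.14368, §8).  The volume of the slice
`{v ∈ ∏ᵢ [eᵢ, eᵢ + w), Σvᵢ = 1}` of a grid cell is `w⁴ B₅(s)`, `s = (1 − Σeᵢ)/w`, with `B₅ = 𝟙_{[0,1)}^{⋆5}` the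
cardinal B-spline (Irwin–Hall density).  Here, in the one-sided convolution algebra of
`Literature.Analysis.Convolution`: the truncated-power primitive (`integral_truncPow`), the recursion
`box^{⋆(n+2)}(x) = ∫_{x−1}^{x} box^{⋆(n+1)}` (`oconv_boxFn_one_eq`, `cpow_boxFn_step`), the closed forms of
`box^{⋆n}` for `n ≤ 5` (`cpow_boxFn_two` … `cpow_boxFn_five`:
`B_{n}(x) = (1/(n−1)!) Σ_{k ≤ n} (−1)^k C(n,k) (x − k)₊^{n−1}` with `(x−k)₊^m := 𝟙[k ≤ x](x−k)^m`), and the five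
values `B₅(6/7) = 54/2401`, `B₅(13/7) = 22081/57624`, `B₅(20/7) = 30155/57624`, `B₅(27/7) = 4091/57624`,
`B₅(34/7) = 1/57624` (the grid heights `s_T = 90/7 − T`, `T = Σtᵢ ∈ {8,…,12}`, of the `ν = 41/250`, `w = 7/500` grid).

References: [FordMaynard2024PrimeSieves] arXiv:2407.14368, §8 (proof of Theorem 2.7 (c)); the B-spline formula is
folklore (Irwin–Hall).
-/

noncomputable section

open MeasureTheory Set Finset intervalIntegral

namespace Summit.Parity.GeneralizedHardyLittlewood.FordMaynardNoSieveConst0164NegWitness0164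

open Literature.Analysis.Convolution

/-! ### Truncated powers -/

/-- The truncated power `𝟙[c ≤ x](x − c)^n` is the indicator of `[c, ∞)` times `(x − c)^n`. [folklore] -/
theorem truncPow_eq_indicator (n : ℕ) (c : ℝ) :
    (fun x : ℝ => if c ≤ x then (x - c) ^ n else 0) = (Set.Ici c).indicator (fun x => (x - c) ^ n) := by
  funext x
  simp only [Set.indicator, Set.mem_Ici]

/-- Truncated powers are interval integrable. [folklore] -/
theorem intervalIntegrable_truncPow (n : ℕ) (c a b : ℝ) :
    IntervalIntegrable (fun x : ℝ => if c ≤ x then (x - c) ^ n else 0) volume a b := by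
  rw [truncPow_eq_indicator]
  have hg : IntervalIntegrable (fun x : ℝ => (x - c) ^ n) volume a b :=
    (by fun_prop : Continuous fun x : ℝ => (x - c) ^ n).intervalIntegrable a b
  exact ⟨hg.1.indicator measurableSet_Ici, hg.2.indicator measurableSet_Ici⟩

/-- **Primitive of a truncated power**: for `a ≤ b`,
`∫_a^b 𝟙[c ≤ x](x−c)^n dx = (𝟙[c ≤ b](b−c)^{n+1} − 𝟙[c ≤ a](a−c)^{n+1})/(n+1)` (also for `n = 0`). [folklore] -/
theorem integral_truncPow (n : ℕ) (c : ℝ) {a b : ℝ} (hab : a ≤ b) :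
    ∫ x in a..b, (if c ≤ x then (x - c) ^ n else 0) =
      ((if c ≤ b then (b - c) ^ (n + 1) else 0) - (if c ≤ a then (a - c) ^ (n + 1) else 0)) / (n + 1) := by
  set F : ℝ → ℝ := fun x => (if c ≤ x then (x - c) ^ (n + 1) else 0) / (n + 1) with hF
  have hn1 : (n : ℝ) + 1 ≠ 0 := by positivity
  -- `F` is the continuous function `max(x − c, 0)^{n+1}/(n+1)`
  have hFmax : F = fun x => (max (x - c) 0) ^ (n + 1) / (n + 1) := by
    funext x
    simp only [hF]
    split_ifs with h
    · rw [max_eq_left (by linarith)]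
    · rw [max_eq_right (by linarith), zero_pow (Nat.succ_ne_zero n)]
  have hFc : Continuous F := by rw [hFmax]; fun_prop
  -- derivative off the kink `c`
  have hFd : ∀ x ∈ Set.Ioo a b \ {c}, HasDerivAt F (if c ≤ x then (x - c) ^ n else 0) x := by
    intro x hx
    have hxc : x ≠ c := hx.2
    rcases lt_or_gt_of_ne hxc with hlt | hgt
    · -- left of the kink: `F = 0` near `x`
      have hev : F =ᶠ[nhds x] fun _ => 0 := by
        filter_upwards [Iio_mem_nhds hlt] with y hy
        simp only [hF, if_neg (not_le.2 (Set.mem_Iio.1 hy)), zero_div]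
      rw [if_neg (not_le.2 hlt)]
      exact (hasDerivAt_const x (0 : ℝ)).congr_of_eventuallyEq hev
    · -- right of the kink: `F = (y − c)^{n+1}/(n+1)` near `x`
      have hev : F =ᶠ[nhds x] fun y => (y - c) ^ (n + 1) / (n + 1) := by
        filter_upwards [Ioi_mem_nhds hgt] with y hy
        simp only [hF, if_pos (le_of_lt (Set.mem_Ioi.1 hy))]
      rw [if_pos hgt.le]
      have h1 : HasDerivAt (fun y : ℝ => (y - c) ^ (n + 1) / (n + 1))
          (((n + 1 : ℕ) : ℝ) * (x - c) ^ n * 1 / (n + 1)) x :=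
        (((hasDerivAt_id x).sub_const c).pow (n + 1)).div_const _
      have h2 : ((n + 1 : ℕ) : ℝ) * (x - c) ^ n * 1 / (n + 1) = (x - c) ^ n := by
        push_cast; field_simp
      rw [h2] at h1
      exact h1.congr_of_eventuallyEq hev
  have key := MeasureTheory.integral_eq_of_hasDerivAt_off_countable_of_le F
    (fun x => if c ≤ x then (x - c) ^ n else 0) hab (Set.countable_singleton c) hFc.continuousOn hFd
    (intervalIntegrable_truncPow n c a b)
  rw [key]
  simp only [hF]
  ring

/-- Shifting the truncation point: `𝟙[c ≤ x − 1](x − 1 − c)^m = 𝟙[c + 1 ≤ x](x − (c+1))^m`. [folklore] -/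
theorem truncPow_sub_one (m : ℕ) (c x : ℝ) :
    (if c ≤ x - 1 then (x - 1 - c) ^ m else 0) = if c + 1 ≤ x then (x - (c + 1)) ^ m else 0 := by
  by_cases h : c + 1 ≤ x
  · rw [if_pos (by linarith), if_pos h]; ring
  · rw [if_neg (by linarith), if_neg h]

/-! ### Convolution with the unit box -/

/-- **Convolution with the unit box is a moving integral**: for `g` locally bounded and vanishing on `(−∞,0)`,
`(g ⋆ 𝟙_{[0,1)})(x) = ∫_{x−1}^{x} g` for every real `x`. [folklore] -/
theorem oconv_boxFn_one_eq (g : ℝ → ℝ) (hg : LocBdd g) (hg0 : ∀ t, t < 0 → g t = 0) (x : ℝ) :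
    oconv g (boxFn 1) x = ∫ t in (x - 1)..x, g t := by
  -- the part of the moving integral over negative `t` vanishes
  have hneg : ∀ {a b : ℝ}, a ≤ b → b ≤ 0 → ∫ t in a..b, g t = 0 := by
    intro a b hab hb
    rw [intervalIntegral.integral_of_le hab, ← setIntegral_congr_set Ioo_ae_eq_Ioc]
    refine (setIntegral_congr_fun measurableSet_Ioo (g := fun _ => (0 : ℝ)) fun t ht => ?_).trans (by simp)
    exact hg0 t (by linarith [ht.2])
  rcases le_or_gt 1 x with h1 | h1
  · rw [oconv_boxFn_eq g h1, intervalIntegral.integral_of_le (by linarith)]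
  rcases le_or_gt x 0 with h0 | h0
  · rw [oconv_of_nonpos h0, hneg (by linarith) h0]
  · -- `0 < x < 1`
    have hii : ∀ a b : ℝ, a ≤ b → IntervalIntegrable g volume a b := fun a b hab =>
      (intervalIntegrable_iff_integrableOn_Ioc_of_le hab).2 (hg.integrableOn_Ioc a b)
    rw [← intervalIntegral.integral_add_adjacent_intervals (hii (x - 1) 0 (by linarith)) (hii 0 x h0.le),
      hneg (by linarith) le_rfl, zero_add, intervalIntegral.integral_of_le h0.le, oconv]
    refine setIntegral_congr_fun measurableSet_Ioc fun t ht => ?_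
    have hb : boxFn 1 (x - t) = 1 := by
      simp only [boxFn]
      rw [if_pos ⟨by linarith [ht.2], by linarith [ht.1]⟩]
    rw [hb, mul_one]

/-! ### The recursion for the box powers -/

/-- **One step of the B-spline recursion.** If `box^{⋆(n+1)}(x) = Σ_{k<n+2} a_k 𝟙[k ≤ x](x−k)^n` for all `x`,
then `box^{⋆(n+2)}(x) = Σ_{k<n+2} a_k (𝟙[k ≤ x](x−k)^{n+1} − 𝟙[k+1 ≤ x](x−k−1)^{n+1})/(n+1)`
(integrate over `[x−1, x]`). [folklore] -/
theorem cpow_boxFn_step (n : ℕ) (a : ℕ → ℝ)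
    (h : ∀ x, cpow (boxFn 1) (n + 1) x =
      ∑ k ∈ Finset.range (n + 2), a k * (if (k : ℝ) ≤ x then (x - k) ^ n else 0)) (x : ℝ) :
    cpow (boxFn 1) (n + 2) x = ∑ k ∈ Finset.range (n + 2), a k *
      (((if (k : ℝ) ≤ x then (x - k) ^ (n + 1) else 0) -
        (if ((k + 1 : ℕ) : ℝ) ≤ x then (x - ((k + 1 : ℕ) : ℝ)) ^ (n + 1) else 0)) / (n + 1)) := by
  have hzero : ∀ t, t < 0 → cpow (boxFn 1) (n + 1) t = 0 := by
    intro t ht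
    rw [h]
    refine Finset.sum_eq_zero fun k _ => ?_
    have hk : (0 : ℝ) ≤ k := Nat.cast_nonneg k
    rw [if_neg (by linarith), mul_zero]
  have hint : (∫ t in (x - 1)..x, cpow (boxFn 1) (n + 1) t) =
      ∫ t in (x - 1)..x, ∑ k ∈ Finset.range (n + 2), a k * (if (k : ℝ) ≤ t then (t - k) ^ n else 0) :=
    intervalIntegral.integral_congr fun t _ => h t
  rw [cpow_succ_succ, oconv_comm (boxFn 1) (cpow (boxFn 1) (n + 1)),
    oconv_boxFn_one_eq _ ((locBdd_boxFn 1).cpow (n + 1)) hzero x, hint,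
    intervalIntegral.integral_finsetSum (fun (k : ℕ) _ =>
      (intervalIntegrable_truncPow n (k : ℝ) _ _).const_mul (a k))]
  refine Finset.sum_congr rfl fun k _ => ?_
  rw [intervalIntegral.integral_const_mul, integral_truncPow n k (by linarith : x - 1 ≤ x), truncPow_sub_one]
  push_cast
  ring

/-- The binomial re-indexing `Σ_{k<n+2} (−1)^k C(n+1,k)/n! · (T_k − T_{k+1})/(n+1) = Σ_{k<n+3} (−1)^k C(n+2,k)/(n+1)! · T_k`
(Pascal's rule), for `n ≤ 3`. [folklore] -/
theorem bspline_reindex (n : ℕ) (hn : n ≤ 3) (T : ℕ → ℝ) :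
    ∑ k ∈ Finset.range (n + 2), ((-1 : ℝ) ^ k * ((n + 1).choose k : ℝ) / (n.factorial : ℝ)) *
        ((T k - T (k + 1)) / (n + 1)) =
      ∑ k ∈ Finset.range (n + 3), ((-1 : ℝ) ^ k * ((n + 2).choose k : ℝ) / ((n + 1).factorial : ℝ)) * T k := by
  interval_cases n <;> simp [Finset.sum_range_succ, Nat.choose, Nat.factorial] <;> ring

/-- **Closed form of the box powers** `box^{⋆(n+1)}`, `n ≤ 4` (cardinal B-splines / Irwin–Hall):
`box^{⋆(n+1)}(x) = (1/n!) Σ_{k ≤ n+1} (−1)^k C(n+1,k) 𝟙[k ≤ x](x − k)^n`. [folklore] -/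
theorem cpow_boxFn_closed : ∀ n : ℕ, n ≤ 4 → ∀ x : ℝ, cpow (boxFn 1) (n + 1) x =
    ∑ k ∈ Finset.range (n + 2), ((-1 : ℝ) ^ k * ((n + 1).choose k : ℝ) / (n.factorial : ℝ)) *
      (if (k : ℝ) ≤ x then (x - k) ^ n else 0)
  | 0, _, x => by
    show cpow (boxFn 1) 1 x = _
    rw [cpow_one]
    simp only [boxFn, Finset.sum_range_succ, Finset.sum_range_zero]
    rcases lt_or_ge x 0 with hx | hx
    · have A : ¬ (0 ≤ x ∧ x < 1) := fun h => by linarith [h.1]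
      have B : ¬ ((0 : ℝ) ≤ x) := by linarith
      have C : ¬ ((1 : ℝ) ≤ x) := by linarith
      norm_num [Nat.choose, Nat.factorial, A, B, C]
    rcases lt_or_ge x 1 with hx1 | hx1
    · have A : (0 ≤ x ∧ x < 1) := ⟨hx, hx1⟩
      have C : ¬ ((1 : ℝ) ≤ x) := by linarith
      norm_num [Nat.choose, Nat.factorial, A, hx, C]
    · have A : ¬ (0 ≤ x ∧ x < 1) := fun h => by linarith [h.2]
      norm_num [Nat.choose, Nat.factorial, A, hx, hx1]
  | n + 1, hn, x => by
    have ih := cpow_boxFn_closed n (by omega)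
    rw [cpow_boxFn_step n _ ih x]
    exact bspline_reindex n (by omega) (fun j => if (j : ℝ) ≤ x then (x - j) ^ (n + 1) else 0)

/-- `B₅ = box^{⋆5}` in closed form. [folklore] -/
theorem cpow_boxFn_five (x : ℝ) : cpow (boxFn 1) 5 x =
    ∑ k ∈ Finset.range 6, ((-1 : ℝ) ^ k * ((5 : ℕ).choose k : ℝ) / ((4 : ℕ).factorial : ℝ)) *
      (if (k : ℝ) ≤ x then (x - k) ^ 4 else 0) :=
  cpow_boxFn_closed 4 le_rfl x

/-! ### The five values -/

/-- `B₅(6/7) = 54/2401` (grid height of the cells with `Σtᵢ = 12`). [folklore] -/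
theorem cpow_boxFn_five_T12 : cpow (boxFn 1) 5 (6 / 7) = 54 / 2401 := by
  rw [cpow_boxFn_five]
  simp only [Finset.sum_range_succ, Finset.sum_range_zero, Nat.choose, Nat.factorial]
  norm_num

/-- `B₅(13/7) = 22081/57624` (grid height of the cells with `Σtᵢ = 11`). [folklore] -/
theorem cpow_boxFn_five_T11 : cpow (boxFn 1) 5 (13 / 7) = 22081 / 57624 := by
  rw [cpow_boxFn_five]
  simp only [Finset.sum_range_succ, Finset.sum_range_zero, Nat.choose, Nat.factorial]
  norm_num

/-- `B₅(20/7) = 30155/57624` (grid height of the cells with `Σtᵢ = 10`). [folklore] -/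
theorem cpow_boxFn_five_T10 : cpow (boxFn 1) 5 (20 / 7) = 30155 / 57624 := by
  rw [cpow_boxFn_five]
  simp only [Finset.sum_range_succ, Finset.sum_range_zero, Nat.choose, Nat.factorial]
  norm_num

/-- `B₅(27/7) = 4091/57624` (grid height of the cells with `Σtᵢ = 9`). [folklore] -/
theorem cpow_boxFn_five_T9 : cpow (boxFn 1) 5 (27 / 7) = 4091 / 57624 := by
  rw [cpow_boxFn_five]
  simp only [Finset.sum_range_succ, Finset.sum_range_zero, Nat.choose, Nat.factorial]
  norm_num

/-- `B₅(34/7) = 1/57624` (grid height of the cells with `Σtᵢ = 8`). [folklore] -/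
theorem cpow_boxFn_five_T8 : cpow (boxFn 1) 5 (34 / 7) = 1 / 57624 := by
  rw [cpow_boxFn_five]
  simp only [Finset.sum_range_succ, Finset.sum_range_zero, Nat.choose, Nat.factorial]
  norm_num

end Summit.Parity.GeneralizedHardyLittlewood.FordMaynardNoSieveConst0164NegWitness0164

end
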